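import Summits.SmoothPoincare4.SmoothPoincare4.Theses.CylinderEntropy
import Literature.Geometry.Riemannian.SphericalCylinderEntropy
import Literature.Geometry.Riemannian.ColdingMinicozziEntropy
import Literature.Geometry.Riemannian.TiltedSliceEntropy

/-!
# `implant-and-saturate` — the SCALE NORMAL FORM of crux E (`CylinderEntropy.ThinCrossSectionExists`,
# stmt-SmoothPoincare4-7633): sorry-free hand-over of the crux-plan (NO SKELETON REGISTERED)

planner-cruxplan-stmt-SmoothPoincare4-7633-implant-and-saturate-0 · crux-plan (opening, round 1) · 2026-08-16.
Idea card `Cruxes/ThinCrossSectionExists/Ideas/implant-and-saturate.md` (ideator 3; triage r1-1 pass (weak), r1-2 pass,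
r1-3 fail).  Verdict of the plan: **no-skeleton** (see `Lines/implant-and-saturate.md`): the only concluding composition
this idea affords is `Saturation → ChordalDomination → MacroWindow → E` (proved below, `crux_of_macroWindow`), and its
load-bearing antecedent `MacroWindow` is E restricted to a finite window of scales — it ASSUMES the thin cross-section
where the topology lives (costume by the planner prompt's definition; SPC4-hard by Disproof `crux_iff_spc4`).  What is
NOT costume is typed and proved here, for the disprover (a sharper target than E), for crux `SliceIsolation` (7632) and
for the route's RUNG-0 certificate format (upper bounds on `λ_cyl` of an explicit cross-section):

* `Saturation` (named debt, SPC4-free, M–L): LARGE SCALES ARE AREA — `𝔥(τ, s) ≤ 1 + 6e^{-4τ}` for `τ ≥ 1`, `|s| ≤ 1`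
  (`𝔥 = zonal`, the typed Gegenbauer series `∑_k e^{-k(k+3)τ}(2k+3)/3 · C_k^{(3/2)}(s) = vol(S⁴)·H_{S⁴}`; spectral gap
  `λ₁(S⁴) = 4`; sharp constant `5.0347` at `τ = 1`, planner numerics).  PROVED from it: `cylDensity_le_of_saturation`,
  `F̂_{p,τ}(A) ≤ (1 + 6e^{-4τ}) · μH⁴(A)/μH⁴(S⁴)`.
* `ChordalDomination` (named debt, SPC4-free, L–XL): SMALL SCALES ARE EUCLIDEAN, with an explicit GLOBAL factor —
  `𝔥(τ, s) ≤ e^{4τ} e^{-(1-s)/(2τ)}/(6τ²)` for all `τ > 0`, `|s| ≤ 1`, i.e. `vol(S⁴)·H_{S⁴}(τ, θ) ≤ e^{4τ}·vol(S⁴)·(4πτ)⁻²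
  e^{-chord²/4τ}` (`G := e^{4τ}(4πτ)⁻²e^{-chord²/4τ}` is a SUPERSOLUTION of the heat equation on `S⁴`:
  `(∂_τ - Δ)G = G·(chord²/4τ - 2)² ≥ 0`, initial trace `δ`; planner numerics: `𝔥/G ≤ 0.9938` on `τ ∈ [0.005, 10]`, `→ 1⁻`).
  PROVED from it: `cylDensity_le_of_chordal`, **`F̂_{p,τ}(A) ≤ e^{4τ} · F_{p,τ}(A)`** for `A ⊆ N`, `p ∈ N`, where `F` is the
  tree's Colding–Minicozzi Gaussian area `Literature.Geometry.Riemannian.gaussianArea 4 p τ A` in `ℝ⁶` (normalised `μHE`,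
  4-planes `↦ 1`) — the bridge `(μH⁴S⁴)⁻¹∫…dμH⁴ = (μHE⁴S⁴)⁻¹∫…dμHE⁴` (`ratio_lintegral_eq`) and `(1/(6τ²))/|S⁴| = (4πτ)⁻²`
  (`normalization_eq`, `|S⁴| = 8π²/3` = tree `euclideanHausdorff_sphere_four`) are proved, so there is no normalisation
  leak (triage r1-3 (D)).  This is the card's implant inequality in closed form (`e^{4τ} ≤ 1.09` for `τ ≤ 1/50`).
* `MacroWindow` (= `E_macro`, the card's Transfer target, typed with EXPLICIT constants as triage r1-1 asked): every
  homotopy 4-sphere has an end-separating cross-section embedding with scale data `0 < r`, `r² ≤ 1/50`, `0 < η`, `1 ≤ τ₁`,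
  `18e^{-4τ₁} ≤ η`: QUIET (`F_{p,t}(range ι) ≤ 5/4` for `p ∈ N`, `t ≤ r²`), LEAN (`μH⁴(range ι)/μH⁴(S⁴) ≤ 4/e - η`), THIN
  ON THE WINDOW (`F̂_{p,τ} ≤ 4/e - η` for `τ ∈ [r², τ₁]`).  PROVED: `cylEntropy_lt_of_window` (split the sup over
  `(0,r²] ∪ [r²,τ₁] ∪ [τ₁,∞)`: `e^{4/50}·5/4 = 1.354`, `4/e - η`, `(1+6e^{-4τ})(4/e-η) ≤ 4/e - η/2`, all `< 4/e`) and
  `crux_of_macroWindow : Saturation → ChordalDomination → MacroWindow → ThinCrossSectionExists`.  Conversely E ⇒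
  `MacroWindow` on paper (compact smooth embedded ⇒ `F → 1` uniformly at small scales; Disproof `measure_lt_of_cylEntropy_lt`;
  strictness of `<`), so refuting `MacroWindow` refutes E: a `-- Targets` candidate for cdisprove, sharper than E because
  the entropy clause lives on finitely many decades of scale with every constant explicit.

Disproof used (`Cruxes/ThinCrossSectionExists/Disproof.lean`, gen-2 end of cycle 2, 641 lines, rc 0 / 0 sorry; landed
`Theorems/ThinCrossSectionExists/Negative/FrameAnalysis.lean`, p72115): `crux_iff_spc4`/`crux_of_spc4` are the costume
yardstick applied above; `false_without_homotopyEquiv/_isManifold/_t2` — the frame is consumed only by `MacroWindow`;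
`not_thinAtLevel_of_le_one` — every bound here is in `(1, 4/e)`; `measure_lt_of_cylEntropy_lt` = the card's `areaBudget`
(already proved there; here only the LEAN hypothesis); `two_le_cylEntropy_twoSlices`, `not_strongE` — nothing here
contradicts them (area is charged; no `∀ ι` claim).  Negatives index: 0.
-/

noncomputable section

open scoped BigOperators ENNReal NNReal Manifold ContDiff Topology ContinuousMap
open MeasureTheory Set
open Literature.Geometry.Riemannian.SphericalCylinderEntropy (cylEntropy cylDensity cylKernel zonal cylKernel_eq
  abs_sum_mul_le_one hausdorffMeasure_sphere_four_pos hausdorffMeasure_sphere_four_lt_top)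
open Literature.Geometry.Riemannian (gaussianArea gaussianWeight gaussianNormalization gaussianArea_eq
  measurable_gaussianWeight)
open Literature.Geometry.Riemannian.TiltedSliceEntropy (euclideanHausdorff_sphere_four)
open Summit.SmoothPoincare4.SmoothPoincare4.Theses.CylinderEntropy (ThinCrossSectionExists)

set_option linter.unusedVariables false
set_option linter.dupNamespace false

namespace Summit.SmoothPoincare4.SmoothPoincare4.Cruxes.ThinCrossSectionExists.ImplantAndSaturate

local notation "E⁶" => EuclideanSpace ℝ (Fin 6)
local notation "E⁵" => EuclideanSpace ℝ (Fin 5)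
local notation "𝕊⁴" => (Metric.sphere (0 : EuclideanSpace ℝ (Fin 5)) 1)

/-! ## Vocabulary (the named statements below inline the crux's own clauses with fully qualified tree names, so that
they can be copied verbatim into a route support item or a `Negative/` target) -/

/-- `z ∈ N = S⁴×ℝ ⊂ ℝ⁶`, literally as in the item: `∑_{i<5} zᵢ² = 1`. -/
abbrev InN (z : E⁶) : Prop := ∑ i : Fin 5, z (Fin.castSucc i) ^ 2 = 1

/-! ## The three named statements (typed debts / targets; nothing is asserted — they are hypotheses below) -/

/-- **SATURATION (M–L, SPC4-free, provable now).** For `τ ≥ 1` and `|s| ≤ 1`,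
`𝔥(τ, s) = ∑_k e^{-k(k+3)τ} (2k+3)/3 · C_k^{(3/2)}(s) ≤ 1 + 6 e^{-4τ}`: the typed zonal kernel is within `6e^{-4τ}` of its
`k = 0` mode.  Why true: `|C_k^{(3/2)}(s)| ≤ C_k^{(3/2)}(1) = (k+1)(k+2)/2` on `[-1, 1]` (non-negative coefficients in the
basis `cos((k-2j)θ)`, from the generating function `(1 - 2s r + r²)^{-3/2} = |1 - r e^{iθ}|^{-3}`), so the `k ≥ 1` tail is
`≤ ∑_{k≥1} e^{-k(k+3)τ}(2k+3)(k+1)(k+2)/6 ≤ e^{-4τ}(5 + ∑_{k≥2} e^{-(k²+3k-4)}(2k+3)(k+1)(k+2)/6) ≤ 5.04 e^{-4τ}` for `τ ≥ 1`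
(planner numerics, 80-digit Gegenbauer recursion: sharp constant `5.0347` at `τ = 1`, `5.0017` at `1.5`, `→ 5`;
`|C_k(s)|/C_k(1) ≤ 1` exactly for `k ≤ 60`).  Crude fallback available in the tree: `abs_term_le` gives `𝔥 ≤ 1 + tail τ`
(`tail τ = e^{-τ}/(1 - e^{-τ})`, mirror of `one_sub_tail_le_zonal`); then the window condition `18e^{-4τ₁} ≤ η` of
`MacroWindow` becomes `3·tail τ₁ ≤ η`.  Leans on: `zonal`, `wt`, `gegen`, `abs_term_le`, `summable_term`, `key_ineq`.
Spectral reading: `4 = λ₁(S⁴) = k(k+3)|_{k=1}`. -/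
def Saturation : Prop :=
  ∀ τ s : ℝ, 1 ≤ τ → |s| ≤ 1 → zonal τ s ≤ 1 + 6 * Real.exp (-4 * τ)

/-- **CHORDAL GAUSSIAN DOMINATION (L–XL, SPC4-free; the implant inequality in closed form).** For all `τ > 0` and
`|s| ≤ 1`, `𝔥(τ, s) ≤ e^{4τ - (1-s)/(2τ)} / (6τ²)`; with `s = cos θ`, `chord² = 2 - 2s`:
`vol(S⁴)·H_{S⁴}(τ, θ) ≤ e^{4τ} · vol(S⁴)·(4πτ)⁻² e^{-chord²/4τ}`.  Why true: on `S⁴` (zonal Laplacian `f'' + 3 cot θ f'`)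
`g := (4πτ)⁻² e^{-chord²/4τ}` satisfies `(∂_τ - Δ) g = g · (chord⁴/16τ² - chord²/τ)`, so `G := e^{4τ} g` has
`(∂_τ - Δ) G = G · (chord²/4τ - 2)² ≥ 0` — a SUPERSOLUTION with initial trace `δ_pole` (`∫ g dvol → 1`); Duhamel plus
positivity of the heat semigroup give `H ≤ G` for all `τ > 0`.  Planner numerics (120 digits, up to 400 modes):
`𝔥/G ≤ 0.9938` on `τ ∈ [0.005, 10] × [-1, 1]`, `→ 1⁻` as `τ → 0` (on-diagonal `𝔥 = (1 + 2τ + O(τ²))·vol·(4πτ)⁻²`, the `2`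
being `R/6`), decaying like `e^{-(π²-4)/4τ}` at the antipode.  In Lean from the raw series this needs positivity of `𝔥`
(shared with `SliceCalibration`'s "≤ 1" half) and a comparison principle for `u_τ = (1-s²)u_ss - 4s u_s` on `[-1, 1]`,
or a Dirichlet–Mehler / dimension-descent representation of `𝔥` by a one-dimensional theta function.  Companion (not
used here; it is the direction crux `SliceIsolation`'s line `conformal-kernel-domination` needs): Cheeger–Yau gives
`𝔥(τ, cos θ) ≥ e^{-θ²/4τ}/(6τ²)` with the GEODESIC distance.  Leans on: `zonal`, `wt`, `gegen`; Mathlib real analysis. -/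
def ChordalDomination : Prop :=
  ∀ τ s : ℝ, 0 < τ → |s| ≤ 1 → zonal τ s ≤ Real.exp (4 * τ - (1 - s) / (2 * τ)) / (6 * τ ^ 2)

/-- **THE MACRO WINDOW `E_macro` (open; SPC4-hard; the crux in scale normal form — NOT a lemma).** Every homotopy
4-sphere `M` (bare summit frame) has a smooth embedding `ι : M → ℝ⁶` into `N`, separating the ends (the item's `JoinedIn`
clause verbatim), with scale data `0 < r`, `r² ≤ 1/50`, `0 < η`, `1 ≤ τ₁`, `18 e^{-4τ₁} ≤ η`, such that
(QUIET) for every `p ∈ N` and `0 < t ≤ r²`, `gaussianArea 4 p t (range ι) ≤ 5/4` (Colding–Minicozzi, `μHE`, planes `↦ 1`);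
(LEAN) `μH⁴(range ι)/μH⁴(S⁴) ≤ 4/e - η`;
(WINDOW) for every `p ∈ N` and `τ ∈ [r², τ₁]`, `cylDensity (range ι) p τ ≤ 4/e - η`.
Status: `⇒ E` given `Saturation` + `ChordalDomination` (`crux_of_macroWindow`); `⇐ E` on paper (compact smooth embedded
`⇒ F → 1` uniformly as `t → 0`, so QUIET below some `r`, `r` tied to the SMALLEST feature of `range ι` — thin necks of
radius `ρ` are legal for E at `λ(S³×ℝ) = 1.4531` but not QUIET above scale `ρ` (triage r1-2 (iii)); LEAN by Disproof
`measure_lt_of_cylEntropy_lt`; WINDOW by the strict `<`; enlarge `τ₁`).  Hence it is E — and SPC4 given `CylinderRungTwo`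
(Disproof `crux_iff_spc4`): true at `M = S⁴` by the slice (LEAN/WINDOW from `SliceCalibration` with any `η ≤ 4/e - 1`,
QUIET with `r² = 1/50` by the small-scale density estimate for the round `S⁴ ⊂ ℝ⁵ ⊂ ℝ⁶`), false at every exotic `M` iff
R.  Use: (a) for an EXPLICIT candidate cross-section the entropy clause is a finite interval-arithmetic certificate on
`[r², τ₁]` at the full threshold `4/e` (RUNG-0 format of the route); (b) for cdisprove a sharper target than E (no
topology below `r` by `ChordalDomination` + CMS Cor 1.5(b); `≤ 0.4715·|S⁴|` of area at scales `≥ r`). -/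
def MacroWindow : Prop :=
  ∀ (M : Type) [TopologicalSpace M] [T2Space M] [SecondCountableTopology M]
    [ChartedSpace (EuclideanSpace ℝ (Fin 4)) M] [IsManifold (𝓡 4) ∞ M],
    M ≃ₕ Metric.sphere (0 : EuclideanSpace ℝ (Fin 5)) 1 →
    ∃ ι : M → EuclideanSpace ℝ (Fin 6), Manifold.IsSmoothEmbedding (𝓡 4) (𝓡 6) ∞ ι ∧
      (∀ x, ∑ i : Fin 5, ι x (Fin.castSucc i) ^ 2 = 1) ∧
      (∃ R : ℝ, ∀ a b : EuclideanSpace ℝ (Fin 6), ∑ i : Fin 5, a (Fin.castSucc i) ^ 2 = 1 →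
        ∑ i : Fin 5, b (Fin.castSucc i) ^ 2 = 1 → a 5 ≤ -R → R ≤ b 5 →
        ¬ JoinedIn ({z : EuclideanSpace ℝ (Fin 6) | ∑ i : Fin 5, z (Fin.castSucc i) ^ 2 = 1} \ Set.range ι) a b) ∧
      ∃ r η τ₁ : ℝ, 0 < r ∧ r ^ 2 ≤ 1 / 50 ∧ 0 < η ∧ 1 ≤ τ₁ ∧ 18 * Real.exp (-4 * τ₁) ≤ η ∧
        (∀ p : EuclideanSpace ℝ (Fin 6), ∑ i : Fin 5, p (Fin.castSucc i) ^ 2 = 1 → ∀ t : ℝ, 0 < t → t ≤ r ^ 2 →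
          Literature.Geometry.Riemannian.gaussianArea 4 p t (Set.range ι) ≤ ENNReal.ofReal (5 / 4)) ∧
        (μH[4] (Metric.sphere (0 : EuclideanSpace ℝ (Fin 5)) 1))⁻¹ * μH[4] (Set.range ι) ≤
          ENNReal.ofReal (4 / Real.exp 1 - η) ∧
        (∀ p : EuclideanSpace ℝ (Fin 6), ∑ i : Fin 5, p (Fin.castSucc i) ^ 2 = 1 → ∀ τ : ℝ, r ^ 2 ≤ τ → τ ≤ τ₁ →
          Literature.Geometry.Riemannian.SphericalCylinderEntropy.cylDensity (Set.range ι) p τ ≤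
            ENNReal.ofReal (4 / Real.exp 1 - η))

/-! ## Glue (proved): from the kernel inequalities to the typed density, and the splitting of the supremum -/

/-- The vertical Gaussian factor of the typed kernel is `≤ 1`. -/
lemma exp_vertical_le_one (z p : E⁶) {τ : ℝ} (hτ : 0 < τ) :
    Real.exp (-((z 5 - p 5) ^ 2) / (4 * τ)) ≤ 1 := by
  rw [Real.exp_le_one_iff]
  exact div_nonpos_of_nonpos_of_nonneg (neg_nonpos.mpr (sq_nonneg _)) (by positivity)

/-- **Saturation ⇒ large-scale density bound**: for `A ⊆ N`, `p ∈ N`, `τ ≥ 1`,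
`F̂_{p,τ}(A) ≤ (1 + 6e^{-4τ}) · μH⁴(A)/μH⁴(S⁴)` (no measurability of `A` needed). -/
theorem cylDensity_le_of_saturation (hS : Saturation) {A : Set E⁶} (hAN : ∀ z ∈ A, InN z) {p : E⁶} (hp : InN p)
    {τ : ℝ} (hτ : 1 ≤ τ) :
    cylDensity A p τ ≤ ENNReal.ofReal (1 + 6 * Real.exp (-4 * τ)) * ((μH[4] 𝕊⁴)⁻¹ * μH[4] A) := by
  rw [cylDensity, mul_left_comm]
  gcongr
  rw [← setLIntegral_const]
  refine setLIntegral_mono measurable_const fun z hz => ?_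
  refine ENNReal.ofReal_le_ofReal ?_
  have hτ0 : 0 < τ := by linarith
  have hs : |∑ i : Fin 5, z (Fin.castSucc i) * p (Fin.castSucc i)| ≤ 1 := abs_sum_mul_le_one (hAN z hz) hp
  have hzon := hS τ _ hτ hs
  have he := exp_vertical_le_one z p hτ0
  have he0 : 0 ≤ Real.exp (-((z 5 - p 5) ^ 2) / (4 * τ)) := (Real.exp_pos _).le
  have hb0 : 0 ≤ 1 + 6 * Real.exp (-4 * τ) := by positivity
  rw [cylKernel_eq]
  by_cases h0 : 0 ≤ zonal τ (∑ i : Fin 5, z (Fin.castSucc i) * p (Fin.castSucc i))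
  · calc _ ≤ zonal τ (∑ i : Fin 5, z (Fin.castSucc i) * p (Fin.castSucc i)) * 1 :=
          mul_le_mul_of_nonneg_left he h0
      _ ≤ _ := by rw [mul_one]; exact hzon
  · calc _ ≤ (0 : ℝ) := mul_nonpos_of_nonpos_of_nonneg (le_of_lt (not_le.mp h0)) he0
      _ ≤ _ := hb0

/-- For `z, p ∈ N`: `‖z - p‖² = 2 - 2⟨z', p'⟩ + (z₅ - p₅)²` (chordal distance on the base plus height). -/
lemma norm_sub_sq_eq {z p : E⁶} (hz : InN z) (hp : InN p) :
    ‖z - p‖ ^ 2 = 2 - 2 * (∑ i : Fin 5, z (Fin.castSucc i) * p (Fin.castSucc i)) + (z 5 - p 5) ^ 2 := by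
  have h1 : ‖z - p‖ ^ 2 = ∑ j : Fin 6, (z j - p j) ^ 2 := by
    rw [EuclideanSpace.norm_sq_eq]
    simp [Real.norm_eq_abs, sq_abs]
  have hsum : ∑ i : Fin 5, (z (Fin.castSucc i) - p (Fin.castSucc i)) ^ 2 =
      2 - 2 * ∑ i : Fin 5, z (Fin.castSucc i) * p (Fin.castSucc i) := by
    have e1 : ∀ i : Fin 5, (z (Fin.castSucc i) - p (Fin.castSucc i)) ^ 2 =
        z (Fin.castSucc i) ^ 2 + p (Fin.castSucc i) ^ 2 - 2 * (z (Fin.castSucc i) * p (Fin.castSucc i)) :=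
      fun i => by ring
    simp only [e1, Finset.sum_sub_distrib, Finset.sum_add_distrib, ← Finset.mul_sum]
    rw [show (∑ i : Fin 5, z (Fin.castSucc i) ^ 2) = 1 from hz, show (∑ i : Fin 5, p (Fin.castSucc i) ^ 2) = 1 from hp]
    ring
  rw [h1, Fin.sum_univ_castSucc, hsum]
  rfl

/-- `μH[4]`-normalised integrals are `μHE[4]`-normalised integrals: the Haar factor relating Mathlib's un-normalised
`μH[4]` to the normalised `μHE[4]` is the same constant on every space (cf. tree `TiltedSliceEntropy.ratio_eq`). -/
lemma ratio_lintegral_eq (s : Set E⁵) (A : Set E⁶) (f : E⁶ → ℝ≥0∞) :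
    (μH[4] s)⁻¹ * ∫⁻ z in A, f z ∂μH[4] =
      ((μHE[4] : Measure E⁵) s)⁻¹ * ∫⁻ z in A, f z ∂(μHE[4] : Measure E⁶) := by
  set c : ℝ≥0 := Measure.addHaarScalarFactor (volume : Measure (EuclideanSpace ℝ (Fin 4)))
    (μH[((4 : ℕ) : ℝ)] : Measure (EuclideanSpace ℝ (Fin 4))) with hc
  have hc0 : (c : ℝ≥0∞) ≠ 0 := by
    rw [hc]; exact_mod_cast Measure.addHaarScalarFactor_volume_hausdorffMeasure_ne_zero 4
  have hct : (c : ℝ≥0∞) ≠ ⊤ := ENNReal.coe_ne_top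
  have hX : (μHE[4] : Measure E⁵) s = (c : ℝ≥0∞) * μH[4] s := by
    rw [Measure.euclideanHausdorffMeasure_def, Measure.smul_apply, ENNReal.smul_def, smul_eq_mul]
    rfl
  have hY : ∫⁻ z in A, f z ∂(μHE[4] : Measure E⁶) = (c : ℝ≥0∞) * ∫⁻ z in A, f z ∂μH[4] := by
    rw [Measure.euclideanHausdorffMeasure_def, Measure.restrict_smul, lintegral_smul_measure, ENNReal.smul_def,
      smul_eq_mul]
    rfl
  rw [hX, hY, ENNReal.mul_inv (Or.inl hc0) (Or.inl hct)]
  calc (μH[4] s)⁻¹ * ∫⁻ z in A, f z ∂μH[4]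
      = (μH[4] s)⁻¹ * (∫⁻ z in A, f z ∂μH[4]) * ((c : ℝ≥0∞)⁻¹ * c) := by
        rw [ENNReal.inv_mul_cancel hc0 hct, mul_one]
    _ = (c : ℝ≥0∞)⁻¹ * (μH[4] s)⁻¹ * ((c : ℝ≥0∞) * ∫⁻ z in A, f z ∂μH[4]) := by ring

/-- The slice normalisation IS the Colding–Minicozzi normalisation: `(1/(6τ²)) / |S⁴| = (4πτ)⁻²` with `|S⁴| = 8π²/3`. -/
lemma normalization_eq {τ : ℝ} (hτ : 0 < τ) :
    ENNReal.ofReal (1 / (6 * τ ^ 2)) * (ENNReal.ofReal (8 * Real.pi ^ 2 / 3))⁻¹ = gaussianNormalization 4 τ := by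
  rw [gaussianNormalization, ← div_eq_mul_inv, ← ENNReal.ofReal_div_of_pos (by positivity)]
  congr 1
  rw [show (-((4 : ℕ) : ℝ) / 2) = -(2 : ℝ) by norm_num, Real.rpow_neg (by positivity), Real.rpow_two]
  have hπ : Real.pi ≠ 0 := Real.pi_pos.ne'
  field_simp
  ring

/-- **Chordal domination ⇒ small-scale density bound**: for `A ⊆ N`, `p ∈ N`, `τ > 0`,
`F̂_{p,τ}(A) ≤ e^{4τ} · F_{p,τ}(A)` with `F` the tree's Colding–Minicozzi Gaussian area in `ℝ⁶` (dimension 4; no measurability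
of `A` needed).  For `z, p ∈ N` the typed kernel is `𝔥(τ, ⟨z',p'⟩) e^{-(z₅-p₅)²/4τ} ≤ e^{4τ} e^{-‖z-p‖²/4τ}/(6τ²)` by `ChordalDomination` and
`‖z - p‖² = (2 - 2⟨z',p'⟩) + (z₅ - p₅)²`; then `(μH⁴S⁴)⁻¹ ∫ … dμH⁴ = (μHE⁴S⁴)⁻¹ ∫ … dμHE⁴` and `(1/(6τ²))/(8π²/3) = (4πτ)⁻²`. -/
theorem cylDensity_le_of_chordal (hC : ChordalDomination) {A : Set E⁶} (hAN : ∀ z ∈ A, InN z) {p : E⁶}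
    (hp : InN p) {τ : ℝ} (hτ : 0 < τ) :
    cylDensity A p τ ≤ ENNReal.ofReal (Real.exp (4 * τ)) * gaussianArea 4 p τ A := by
  -- pointwise on `A`
  have hpt : ∀ z ∈ A, ENNReal.ofReal (cylKernel p τ z) ≤
      ENNReal.ofReal (Real.exp (4 * τ)) * (ENNReal.ofReal (1 / (6 * τ ^ 2)) * gaussianWeight p τ z) := by
    intro z hz
    rw [gaussianWeight, ← ENNReal.ofReal_mul (by positivity), ← ENNReal.ofReal_mul (Real.exp_pos _).le]
    refine ENNReal.ofReal_le_ofReal ?_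
    set s : ℝ := ∑ i : Fin 5, z (Fin.castSucc i) * p (Fin.castSucc i) with hs_def
    have hs : |s| ≤ 1 := abs_sum_mul_le_one (hAN z hz) hp
    have hzon := hC τ s hτ hs
    have he0 : 0 ≤ Real.exp (-((z 5 - p 5) ^ 2) / (4 * τ)) := (Real.exp_pos _).le
    have hnorm := norm_sub_sq_eq (hAN z hz) hp
    have hexp : Real.exp (4 * τ - (1 - s) / (2 * τ)) * Real.exp (-((z 5 - p 5) ^ 2) / (4 * τ)) =
        Real.exp (4 * τ) * Real.exp (-(‖z - p‖ ^ 2) / (4 * τ)) := by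
      rw [← Real.exp_add, ← Real.exp_add, hnorm]
      congr 1
      field_simp
      ring
    rw [cylKernel_eq]
    calc zonal τ s * Real.exp (-((z 5 - p 5) ^ 2) / (4 * τ))
        ≤ Real.exp (4 * τ - (1 - s) / (2 * τ)) / (6 * τ ^ 2) * Real.exp (-((z 5 - p 5) ^ 2) / (4 * τ)) :=
          mul_le_mul_of_nonneg_right hzon he0
      _ = Real.exp (4 * τ) * (1 / (6 * τ ^ 2) * Real.exp (-(‖z - p‖ ^ 2) / (4 * τ))) := by
          rw [div_mul_eq_mul_div, hexp]
          field_simp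
  -- integrate over `A`
  have hmeas : Measurable fun z : E⁶ =>
      ENNReal.ofReal (Real.exp (4 * τ)) * (ENNReal.ofReal (1 / (6 * τ ^ 2)) * gaussianWeight p τ z) :=
    ((measurable_gaussianWeight p τ).const_mul _).const_mul _
  have hint : ∫⁻ z in A, ENNReal.ofReal (cylKernel p τ z) ∂μH[4] ≤
      ENNReal.ofReal (Real.exp (4 * τ)) * (ENNReal.ofReal (1 / (6 * τ ^ 2)) * ∫⁻ z in A, gaussianWeight p τ z ∂μH[4]) := by
    have h := setLIntegral_mono (μ := μH[4]) (s := A) hmeas hpt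
    rwa [lintegral_const_mul' _ _ ENNReal.ofReal_ne_top, lintegral_const_mul' _ _ ENNReal.ofReal_ne_top] at h
  -- constants: slice normalisation = Colding–Minicozzi normalisation
  rw [cylDensity, gaussianArea_eq]
  calc (μH[4] 𝕊⁴)⁻¹ * ∫⁻ z in A, ENNReal.ofReal (cylKernel p τ z) ∂μH[4]
      ≤ (μH[4] 𝕊⁴)⁻¹ * (ENNReal.ofReal (Real.exp (4 * τ)) *
          (ENNReal.ofReal (1 / (6 * τ ^ 2)) * ∫⁻ z in A, gaussianWeight p τ z ∂μH[4])) := by gcongr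
    _ = ENNReal.ofReal (Real.exp (4 * τ)) * (ENNReal.ofReal (1 / (6 * τ ^ 2)) *
          ((μH[4] 𝕊⁴)⁻¹ * ∫⁻ z in A, gaussianWeight p τ z ∂μH[4])) := by ring
    _ = ENNReal.ofReal (Real.exp (4 * τ)) * (ENNReal.ofReal (1 / (6 * τ ^ 2)) *
          (((μHE[4] : Measure E⁵) 𝕊⁴)⁻¹ * ∫⁻ z in A, gaussianWeight p τ z ∂(μHE[4] : Measure E⁶))) := by
          rw [ratio_lintegral_eq]
    _ = ENNReal.ofReal (Real.exp (4 * τ)) *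
          (gaussianNormalization 4 τ * ∫⁻ z in A, gaussianWeight p τ z ∂(μHE[4] : Measure E⁶)) := by
          rw [euclideanHausdorff_sphere_four, ← mul_assoc (ENNReal.ofReal (1 / (6 * τ ^ 2))), normalization_eq hτ]

/-- The numerical heart of the small-scale regime: `e^{4/50} · 5/4 < 4/e` (`1.354 < 1.4715`). -/
lemma small_scale_bound_lt : Real.exp (4 * (1 / 50)) * (5 / 4) < 4 / Real.exp 1 := by
  have h1 : Real.exp (4 * (1 / 50)) ≤ 1 / (1 - 4 * (1 / 50)) :=
    Real.exp_bound_div_one_sub_of_interval (by norm_num) (by norm_num)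
  have h2 := Real.exp_one_lt_d9
  have h3 := Real.exp_pos (1 : ℝ)
  have h4 := Real.exp_pos (4 * (1 / 50) : ℝ)
  rw [lt_div_iff₀ h3]
  have h5 : Real.exp (4 * (1 / 50)) * Real.exp 1 ≤ 1 / (1 - 4 * (1 / 50)) * 2.7182818286 :=
    mul_le_mul h1 h2.le h3.le (by norm_num)
  nlinarith [h5]

/-- `4/e < 3/2` (`e > 8/3`). -/
lemma four_div_exp_one_lt : 4 / Real.exp 1 < 3 / 2 := by
  rw [div_lt_iff₀ (Real.exp_pos 1)]
  have := Real.exp_one_gt_d9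
  linarith

/-- **`E_macro ⇒ E` at the level of one set**: QUIET + LEAN + WINDOW (with the explicit scale data) and the two kernel
inequalities give `λ_cyl(A) < 4/e`, by splitting the supremum over `τ ∈ (0, r²] ∪ [r², τ₁] ∪ [τ₁, ∞)`. -/
theorem cylEntropy_lt_of_window (hS : Saturation) (hC : ChordalDomination) {A : Set E⁶} (hAN : ∀ z ∈ A, InN z)
    {r η τ₁ : ℝ} (hr : 0 < r) (hr2 : r ^ 2 ≤ 1 / 50) (hη : 0 < η) (hτ₁ : 1 ≤ τ₁)
    (hsat : 18 * Real.exp (-4 * τ₁) ≤ η)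
    (hquiet : ∀ p : E⁶, InN p → ∀ t : ℝ, 0 < t → t ≤ r ^ 2 → gaussianArea 4 p t A ≤ ENNReal.ofReal (5 / 4))
    (harea : (μH[4] 𝕊⁴)⁻¹ * μH[4] A ≤ ENNReal.ofReal (4 / Real.exp 1 - η))
    (hwin : ∀ p : E⁶, InN p → ∀ τ : ℝ, r ^ 2 ≤ τ → τ ≤ τ₁ →
      cylDensity A p τ ≤ ENNReal.ofReal (4 / Real.exp 1 - η)) :
    cylEntropy A < ENNReal.ofReal (4 / Real.exp 1) := by
  set c : ℝ := 4 / Real.exp 1 with hc_def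
  have hc0 : 0 < c := by positivity
  have hc32 : c < 3 / 2 := four_div_exp_one_lt
  set b : ℝ := max (Real.exp (4 * (1 / 50)) * (5 / 4)) (c - η / 2) with hb_def
  have hb : b < c := max_lt small_scale_bound_lt (by linarith)
  -- the three regimes
  have key : ∀ p : E⁶, InN p → ∀ τ : ℝ, 0 < τ → cylDensity A p τ ≤ ENNReal.ofReal b := by
    intro p hp τ hτ
    rcases le_or_gt τ (r ^ 2) with hsmall | hlarge
    · -- small scales: chordal domination + QUIET
      calc cylDensity A p τ ≤ ENNReal.ofReal (Real.exp (4 * τ)) * gaussianArea 4 p τ A :=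
            cylDensity_le_of_chordal hC hAN hp hτ
        _ ≤ ENNReal.ofReal (Real.exp (4 * τ)) * ENNReal.ofReal (5 / 4) := by
            gcongr; exact hquiet p hp τ hτ hsmall
        _ = ENNReal.ofReal (Real.exp (4 * τ) * (5 / 4)) := (ENNReal.ofReal_mul (Real.exp_pos _).le).symm
        _ ≤ ENNReal.ofReal b := by
            refine ENNReal.ofReal_le_ofReal (le_trans ?_ (le_max_left _ _))
            have : Real.exp (4 * τ) ≤ Real.exp (4 * (1 / 50)) := Real.exp_le_exp.mpr (by linarith)
            nlinarith [Real.exp_pos (4 * τ)]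
    · rcases le_or_gt τ τ₁ with hmid | hfar
      · -- the window
        calc cylDensity A p τ ≤ ENNReal.ofReal (c - η) := hwin p hp τ hlarge.le hmid
          _ ≤ ENNReal.ofReal b := ENNReal.ofReal_le_ofReal (le_trans (by linarith) (le_max_right _ _))
      · -- large scales: saturation + LEAN
        have hτ1 : 1 ≤ τ := le_trans hτ₁ hfar.le
        have hE : Real.exp (-4 * τ) ≤ Real.exp (-4 * τ₁) := Real.exp_le_exp.mpr (by linarith)
        have hE0 : 0 ≤ Real.exp (-4 * τ) := (Real.exp_pos _).le
        have hreal : (1 + 6 * Real.exp (-4 * τ)) * (c - η) ≤ c - η / 2 := by nlinarith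
        calc cylDensity A p τ ≤ ENNReal.ofReal (1 + 6 * Real.exp (-4 * τ)) * ((μH[4] 𝕊⁴)⁻¹ * μH[4] A) :=
              cylDensity_le_of_saturation hS hAN hp hτ1
          _ ≤ ENNReal.ofReal (1 + 6 * Real.exp (-4 * τ)) * ENNReal.ofReal (c - η) := by gcongr
          _ = ENNReal.ofReal ((1 + 6 * Real.exp (-4 * τ)) * (c - η)) := (ENNReal.ofReal_mul (by positivity)).symm
          _ ≤ ENNReal.ofReal b := ENNReal.ofReal_le_ofReal (le_trans hreal (le_max_right _ _))
  have hsup : cylEntropy A ≤ ENNReal.ofReal b := by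
    refine iSup₂_le fun p hp => iSup₂_le fun τ hτ => ?_
    exact key p hp τ hτ
  exact lt_of_le_of_lt hsup ((ENNReal.ofReal_lt_ofReal_iff hc0).mpr hb)

/-! ## The composition: the normal form implies the crux (sorry-free, conditional on the three named statements) -/

/-- **`ThinCrossSectionExists` from `Saturation`, `ChordalDomination`, `MacroWindow`** (pure logic over the glue above):
given `M ≃ₕ S⁴`, `MacroWindow` supplies the cross-section `ι` with its scale data; `cylEntropy_lt_of_window` turns
QUIET + LEAN + WINDOW into `λ_cyl(range ι) < 4/e`, which is the item's entropy clause definitionally.  NOT a proof line: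
`MacroWindow` is E on its hard window (see the module docstring and `Lines/implant-and-saturate.md`). -/
theorem crux_of_macroWindow (h1 : Saturation) (h2 : ChordalDomination) (h3 : MacroWindow) :
    ThinCrossSectionExists := by
  intro M _ _ _ _ _ e
  obtain ⟨ι, hι, hN, hsep, r, η, τ₁, hr, hr2, hη, hτ₁, hsat, hquiet, harea, hwin⟩ := h3 M e
  refine ⟨ι, hι, hN, hsep, ?_⟩
  have hAN : ∀ z ∈ Set.range ι, InN z := by
    rintro z ⟨x, rfl⟩; exact hN x
  exact cylEntropy_lt_of_window h1 h2 hAN hr hr2 hη hτ₁ hsat hquiet harea hwin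

/-- The converse `E ⇒ MacroWindow` (paper proof in the module docstring; typed, not proved, not assumed anywhere): with
`crux_of_macroWindow` it says `MacroWindow ⟺ E` given the two kernel inequalities — refuting `MacroWindow` refutes E. -/
def NormalFormConverse : Prop := ThinCrossSectionExists → MacroWindow

end Summit.SmoothPoincare4.SmoothPoincare4.Cruxes.ThinCrossSectionExists.ImplantAndSaturate

end
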